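import Literature.Barriers.ValiantsHypothesis.BDGIL24CentralCharacterSeparation
import HarnessLib

/-!
# [BDGIL24, eq. (9)–(10)]: the Perelomov–Popov formula `χ_λ(C_p) = Tr(A_λ^p E)` for the eigenvalues of
# the Casimir elements of `gl_k` on highest weight vectors — PROVED (`BergEtAl2024.eq_9_perelomovPopov`)

[BDGIL24] = M. van den Berg, P. Dutta, F. Gesmundo, C. Ikenmeyer, V. Lysikov, *Algebraic
metacomplexity and representation theory*, arXiv:2411.03444, §4.4 (p.21, PDF p.22; held text
paper:arxiv-2411.03444 p0022.txt:L1–L6, L32–L45):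

> "There are several constructions of Casimir elements, one possible choice being
> `C_p := Σ_{i_1=1}^k ⋯ Σ_{i_p=1}^k E_{i_1,i_2} E_{i_2,i_3} ⋯ E_{i_p,i_1}` with `1 ≤ p ≤ k`. (8) […] The
> eigenvalues of these Casimir elements on irreducible representations of `gl_k` are computed by
> Perelomov and Popov [PP68]: `χ_λ(C_p) = Tr(A_λ^p E)` (9) where `E` is the `k × k` matrix consisting
> of all ones, and the entries of the `k × k` matrix `A_λ = (a^{(λ)}_{ij})` are given by
> `a^{(λ)}_{ij} = λ_i + k − i` if `i = j`, `0` if `i > j`, `−1` if `i < j`. (10)"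

## What is typed and proved

In the block matrix model `U(T → gl_n)` of the tree's Harish-Chandra core (`HarishChandraCore`;
`HCCore.casimir n τ p = tr(𝔼_τ^p)` is (8) in block `τ`, `HCCore.genMatU` the matrix of generators,
`IsHighestWeightVectorC` the highest weight vectors of `HighestWeightGL`):

* `ppMatrix lam` — the matrix `A_λ` of (10) (0-indexed: `λ_a + (n − 1 − a)` on the diagonal, i.e.
  `λ_i + k − i` for the printed 1-indexed `i = a + 1`; `−1` above, `0` below the diagonal);
* **`lift_genMatU_pow_apply_hw`** — on a highest weight vector `v` of weight `λ` (of ANY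
  representation of `gl_n^T`), the raising entries `(𝔼^p)_{ab}`, `a < b`, of the powers of the matrix
  of generators act by `0` and the diagonal entries `(𝔼^p)_{aa}` act by the scalars
  `s^{(p)}_a = (A_λ^p 𝟙)_a` (`ppVec`, `ppVec_eq_mulVec`) — induction on `p` from the commutation rule
  `[E_{cd}, (𝔼^p)_{ab}] = δ_{da}(𝔼^p)_{cb} − δ_{cb}(𝔼^p)_{ad}` (the tree's `HCCore.map_adU_genMatU_pow`);
* **`eq_9_perelomovPopov`** — hence `C_p · v = Tr(A_λ^p E) · v` (`Tr(A^p E) = Σ_{a,b} (A^p)_{ab}`,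
  `trace_mul_allOnes`): the printed (9)–(10) for the central character of any highest weight module,
  in particular of the irreducible `V_λ`;
* **`envActGL_casimir_apply_eq_trace`** — on the `λ`-isotypic component of the metapolynomials
  `ℂ[ℂ[x₁,…,x_k]_d]_δ` the Casimir element `C_p` acts by `Tr(A_λ^p E)` (combining with
  `envActGL_center_apply_of_mem_hwSubrep` of `BDGIL24CentralCharacters`), the input of the printed
  Remark 5.3 / Example 5.4 / Table 5.3 ("these values … can be computed using eq. (9)").

Proof route (disclosed): an elementary induction on `p` inside `U(gl_n)` acting on `v` (the
derivation of [PP68] itself is not held and not followed); the statement is (9)–(10) verbatim, and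
the printed numerical instances (Examples 4.15, 5.4) are recomputed from it (`example_4_15`).

Honest framing: representation-theoretic bookkeeping; nothing here bears on `VP ≠ VNP`.

## References
* [BergEtAl2024] arXiv:2411.03444, §4.4, eq. (8)–(10) (p.21, PDF p.22), Remark 5.3, Example 5.4.
* [PerelomovPopov1968] A. M. Perelomov, V. S. Popov, *Casimir operators for semisimple Lie groups*,
  Math. USSR Izv. 2 (1968) 1313–1335 (doi 10.1070/im1968v002n06abeh000731) — the reference [PP68]
  of [BDGIL24] for (9); attribution only (not held, not read: the proof below is self-contained).
-/

noncomputable section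

-- Mathlib idiom: the commutator bracket on an associative algebra (`T → Matrix (Fin n) (Fin n) ℂ`),
-- as in the imported `BDGIL24CentralCharacters` / `HarishChandraCore`
attribute [local instance 100] LieRing.ofAssociativeRing

open MvPolynomial UniversalEnvelopingAlgebra
open scoped BigOperators

namespace Literature.Barriers.ValiantsHypothesis

namespace BergEtAl2024

open Literature.NumberTheory.Automorphic Literature.NumberTheory.Automorphic.HCCore
open Literature.Algebra.Lie.PBW Literature.Algebra.Lie.ChevalleyGL

/-! ### The matrix `A_λ` of (10) and the vectors `A_λ^p 𝟙` -/

section PPMatrix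

variable {n : ℕ}

/-- **The Perelomov–Popov matrix `A_λ` of [BDGIL24, (10)]**: `a_{ab} = λ_a + (n − 1 − a)` if `a = b`
(0-indexed `a`; the printed `λ_i + k − i` for the 1-indexed `i = a + 1`), `−1` if `a < b`, `0` if
`a > b`. [cite: BergEtAl2024, eq. (10), p.21 (PDF p.22)] locator: paper:arxiv-2411.03444 p0022.txt:L36–L45
[cite: PerelomovPopov1968] ([PP68] of [BDGIL24, (9)]; attribution, source not held) -/
def ppMatrix (lam : Fin n → ℂ) : Matrix (Fin n) (Fin n) ℂ :=
  Matrix.of fun a b => if a = b then lam a + ((n - 1 - (a : ℕ) : ℕ) : ℂ) else if a < b then -1 else 0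

/-- Entries of `A_λ`. [cite: BergEtAl2024, eq. (10), p.21 (PDF p.22)] -/
theorem ppMatrix_apply (lam : Fin n → ℂ) (a b : Fin n) :
    ppMatrix lam a b = if a = b then lam a + ((n - 1 - (a : ℕ) : ℕ) : ℂ) else if a < b then -1 else 0 :=
  rfl

/-- **The scalars `s^{(p)} = A_λ^p 𝟙`** by which the diagonal entries `(𝔼^p)_{aa}` act on a highest
weight vector of weight `λ`, through their recursion
`s^{(p+1)}_a = λ_a s^{(p)}_a + Σ_{m > a} (s^{(p)}_a − s^{(p)}_m)`, `s^{(0)} = 𝟙` (see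
`ppVec_eq_mulVec`). [cite: BergEtAl2024, eq. (9)–(10), p.21 (PDF p.22)] -/
def ppVec (lam : Fin n → ℂ) : ℕ → Fin n → ℂ
  | 0 => fun _ => 1
  | p + 1 => fun a => lam a * ppVec lam p a +
      ∑ m ∈ Finset.univ.filter (fun m : Fin n => a < m), (ppVec lam p a - ppVec lam p m)

/-- `s^{(0)} = 𝟙`. [cite: BergEtAl2024, eq. (9)–(10), p.21 (PDF p.22)] -/
@[simp] theorem ppVec_zero (lam : Fin n → ℂ) (a : Fin n) : ppVec lam 0 a = 1 := rfl

/-- The recursion of `s^{(p)}`. [cite: BergEtAl2024, eq. (9)–(10), p.21 (PDF p.22)] -/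
theorem ppVec_succ (lam : Fin n → ℂ) (p : ℕ) (a : Fin n) :
    ppVec lam (p + 1) a = lam a * ppVec lam p a +
      ∑ m ∈ Finset.univ.filter (fun m : Fin n => a < m), (ppVec lam p a - ppVec lam p m) := rfl

/-- The number of indices above `a` is `n − 1 − a` (`= k − i` for the printed `i = a + 1`).
[cite: BergEtAl2024, eq. (10), p.21 (PDF p.22)] -/
theorem card_filter_gt (a : Fin n) :
    (Finset.univ.filter (fun m : Fin n => a < m)).card = n - 1 - (a : ℕ) := by
  rw [Finset.filter_lt_eq_Ioi, Fin.card_Ioi]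

/-- One step of the recursion is multiplication by `A_λ`: `A_λ s = (λ_a s_a + Σ_{m>a}(s_a − s_m))_a`.
[cite: BergEtAl2024, eq. (10), p.21 (PDF p.22)] -/
theorem ppMatrix_mulVec (lam : Fin n → ℂ) (s : Fin n → ℂ) (a : Fin n) :
    (ppMatrix lam).mulVec s a =
      lam a * s a + ∑ m ∈ Finset.univ.filter (fun m : Fin n => a < m), (s a - s m) := by
  classical
  simp only [Matrix.mulVec, dotProduct]
  have hterm : ∀ m : Fin n, ppMatrix lam a m * s m =
      (if m = a then (lam a + ((n - 1 - (a : ℕ) : ℕ) : ℂ)) * s a else 0) +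
        (if a < m then -s m else 0) := by
    intro m
    rw [ppMatrix_apply]
    by_cases hma : m = a
    · subst hma
      rw [if_pos rfl, if_pos rfl, if_neg (lt_irrefl _), add_zero]
    · rw [if_neg (Ne.symm hma), if_neg hma, zero_add]
      by_cases ham : a < m
      · rw [if_pos ham, if_pos ham, neg_one_mul]
      · rw [if_neg ham, if_neg ham, zero_mul]
  rw [Finset.sum_congr rfl fun m _ => hterm m, Finset.sum_add_distrib, Finset.sum_ite_eq' Finset.univ a,
    if_pos (Finset.mem_univ a), ← Finset.sum_filter, Finset.sum_sub_distrib, Finset.sum_const,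
    card_filter_gt, nsmul_eq_mul, Finset.sum_neg_distrib]
  ring

/-- **`s^{(p)} = A_λ^p 𝟙`.** [cite: BergEtAl2024, eq. (9)–(10), p.21 (PDF p.22)] -/
theorem ppVec_eq_mulVec (lam : Fin n → ℂ) (p : ℕ) :
    ppVec lam p = (ppMatrix lam ^ p).mulVec (fun _ => 1) := by
  induction p with
  | zero =>
    funext a
    rw [ppVec_zero, pow_zero, Matrix.one_mulVec]
  | succ p ih =>
    funext a
    rw [ppVec_succ, pow_succ', ← Matrix.mulVec_mulVec, ← ih, ppMatrix_mulVec]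

/-- `Tr(M E) = Σ_{a,b} M_{ab}` for the all-ones matrix `E`. [cite: BergEtAl2024, eq. (9), p.21 (PDF p.22)] -/
theorem trace_mul_allOnes (M : Matrix (Fin n) (Fin n) ℂ) :
    Matrix.trace (M * Matrix.of fun _ _ : Fin n => (1 : ℂ)) = ∑ a, ∑ b, M a b := by
  rw [Matrix.trace]
  refine Finset.sum_congr rfl fun a _ => ?_
  rw [Matrix.diag_apply, Matrix.mul_apply]
  exact Finset.sum_congr rfl fun b _ => by rw [Matrix.of_apply, mul_one]

/-- `Tr(A_λ^p E) = Σ_a s^{(p)}_a`. [cite: BergEtAl2024, eq. (9), p.21 (PDF p.22)] -/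
theorem trace_ppMatrix_pow_mul_allOnes (lam : Fin n → ℂ) (p : ℕ) :
    Matrix.trace (ppMatrix lam ^ p * Matrix.of fun _ _ : Fin n => (1 : ℂ)) = ∑ a, ppVec lam p a := by
  rw [trace_mul_allOnes, ppVec_eq_mulVec]
  refine Finset.sum_congr rfl fun a _ => ?_
  simp only [Matrix.mulVec, dotProduct]
  exact Finset.sum_congr rfl fun b _ => (mul_one _).symm

/-- `s^{(1)} = λ` (`A_λ 𝟙 = λ`: the `−1`'s above the diagonal cancel the shift `n − 1 − a`).
[cite: BergEtAl2024, eq. (10), p.21 (PDF p.22)] -/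
theorem ppVec_one (lam : Fin n → ℂ) (a : Fin n) : ppVec lam 1 a = lam a := by
  rw [ppVec_succ]
  simp

/-- **`Tr(A_λ E) = Σ_a λ_a = |λ|`**: by (9) the first Casimir element `C_1 = Σ_i E_{ii}` acts by
`|λ|` ("in fact, one can show `C_1` always scales a metapolynomial of format `(δ, d, k)` by `dδ`").
[cite: BergEtAl2024, Example 4.14, p.21 (PDF p.22)] locator: paper:arxiv-2411.03444 p0022.txt:L20–L21 -/
theorem trace_ppMatrix_mul_allOnes (lam : Fin n → ℂ) :
    Matrix.trace (ppMatrix lam * Matrix.of fun _ _ : Fin n => (1 : ℂ)) = ∑ a, lam a := by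
  rw [← pow_one (ppMatrix lam), trace_ppMatrix_pow_mul_allOnes]
  exact Finset.sum_congr rfl fun a _ => ppVec_one lam a

/-- **The printed examples of (9)–(10)** ([BDGIL24, Example 4.15]: `χ_{(4,0)}(C_2) = 20`,
`χ_{(2,2)}(C_2) = 8` — matching `C_2.Δ = 20Δ`, `C_2.Γ = 8Γ` of Example 4.14 — and
`χ_{(6,0,0)}(C_2) = 48`; [BDGIL24, Example 5.4]: `C_2` scales the `(6,0,0)`, `(4,2,0)`, `(2,2,2)`
isotypic components by `48`, `28`, `12`), recomputed from `ppMatrix`. (Faithfulness check of the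
0-indexed transcription of (10). Note: Example 4.15 prints `A_{(4,0)} = [[5,−1],[0,2]]`, whose
`Tr(A^2 E)` would be `22`; by (10) `a_{22} = λ_2 + k − 2 = 0`, `A_{(4,0)} = [[5,−1],[0,0]]` and
`Tr(A^2 E) = 20`, the value printed there and in Example 4.14 — the `2` is a misprint.)
[cite: BergEtAl2024, Example 4.15, p.21 (PDF p.22); Example 5.4, p.26 (PDF p.27)] locator: paper:arxiv-2411.03444 p0022.txt:L51–L89 -/
theorem example_4_15 :
    Matrix.trace (ppMatrix ![(4 : ℂ), 0] ^ 2 * Matrix.of fun _ _ : Fin 2 => (1 : ℂ)) = 20 ∧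
    Matrix.trace (ppMatrix ![(2 : ℂ), 2] ^ 2 * Matrix.of fun _ _ : Fin 2 => (1 : ℂ)) = 8 ∧
    Matrix.trace (ppMatrix ![(6 : ℂ), 0, 0] ^ 2 * Matrix.of fun _ _ : Fin 3 => (1 : ℂ)) = 48 ∧
    Matrix.trace (ppMatrix ![(4 : ℂ), 2, 0] ^ 2 * Matrix.of fun _ _ : Fin 3 => (1 : ℂ)) = 28 ∧
    Matrix.trace (ppMatrix ![(2 : ℂ), 2, 2] ^ 2 * Matrix.of fun _ _ : Fin 3 => (1 : ℂ)) = 12 := by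
  refine ⟨?_, ?_, ?_, ?_, ?_⟩ <;> rw [trace_ppMatrix_pow_mul_allOnes] <;>
    simp only [Fin.sum_univ_two, Fin.sum_univ_three, ppVec_succ, ppVec_zero, Finset.sum_filter,
      Fin.isValue] <;>
    norm_num [Fin.lt_def, Matrix.cons_val_two, Matrix.tail_cons, Matrix.head_cons]

end PPMatrix

/-! ### The powers of the matrix of generators on a highest weight vector -/

section HW

variable {T : Type*} [Fintype T] [DecidableEq T] {n : ℕ}
variable {V : Type*} [AddCommGroup V] [Module ℂ V]
  {ρ : (T → Matrix (Fin n) (Fin n) ℂ) →ₗ⁅ℂ⁆ Module.End ℂ V} {l : T → Fin n → ℂ} {v : V}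

/-- **The commutation rule `[E_{cd}, (𝔼^p)_{ab}] = δ_{da}(𝔼^p)_{cb} − δ_{cb}(𝔼^p)_{ad}`** in `U(gl_n^T)`
(block `τ`): the powers of the matrix of generators transform like `𝔼` under `ad` — the entrywise
form of the tree's `HCCore.map_adU_genMatU_pow` (`C_p`, `𝔼` as in [BDGIL24, (8)]). [folklore]
[cite: BergEtAl2024, eq. (8), p.21 (PDF p.22)] -/
theorem adU_genMatU_pow_apply (τ : T) (c d a b : Fin n) (p : ℕ) :
    adU (R := ℂ) (stdB T n (τ, c, d)) ((genMatU n τ ^ p) a b) =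
      (if d = a then (genMatU n τ ^ p) c b else 0) - (if c = b then (genMatU n τ ^ p) a d else 0) := by
  have h := map_adU_genMatU_pow (T := T) (n := n) (τ, c, d) τ p
  rw [if_pos rfl] at h
  have h' := congr_fun (congr_fun h a) b
  rw [Matrix.map_apply, Matrix.sub_apply, single_one_mul_apply, mul_single_one_apply] at h'
  exact h'

omit [DecidableEq T] in
/-- A generator applied after an element of `U(𝔤)`: `E_{cd} · (u · v) = [E_{cd}, u] · v + u · (E_{cd} · v)`
(plumbing). [folklore] -/
private theorem rho_stdB_lift_apply (τ : T) (c d : Fin n)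
    (u : UniversalEnvelopingAlgebra ℂ (T → Matrix (Fin n) (Fin n) ℂ)) (w : V) :
    ρ (stdB T n (τ, c, d)) (lift ℂ ρ u w) =
      lift ℂ ρ (adU (R := ℂ) (stdB T n (τ, c, d)) u) w + lift ℂ ρ u (ρ (stdB T n (τ, c, d)) w) := by
  rw [adU_apply, map_sub, LinearMap.sub_apply, map_mul, map_mul, lift_ι_apply, Module.End.mul_apply,
    Module.End.mul_apply, sub_add_cancel]

/-- **The powers `𝔼^p` of the matrix of generators on a highest weight vector `v` of weight `λ`**:
the raising entries `(𝔼^p)_{ab}`, `a < b`, kill `v`, and the diagonal entries `(𝔼^p)_{aa}` multiply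
it by `s^{(p)}_a = (A_λ^p 𝟙)_a` (`ppVec`). Induction on `p`, expanding
`(𝔼^{p+1})_{ab} = Σ_m E_{am} (𝔼^p)_{mb}` and moving each raising `E_{am}`, `m > a`, through with the
commutation rule `adU_genMatU_pow_apply` (it then kills `v`).
[cite: BergEtAl2024, eq. (9)–(10), p.21 (PDF p.22)] locator: paper:arxiv-2411.03444 p0022.txt:L32–L45
[cite: PerelomovPopov1968] ([PP68] of [BDGIL24, (9)]; attribution, source not held) -/
theorem lift_genMatU_pow_apply_hw (hv : IsHighestWeightVectorC ρ l v) (τ : T) (p : ℕ) :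
    (∀ a b : Fin n, a < b → lift ℂ ρ ((genMatU n τ ^ p) a b) v = 0) ∧
      ∀ a : Fin n, lift ℂ ρ ((genMatU n τ ^ p) a a) v = ppVec (l τ) p a • v := by
  classical
  induction p with
  | zero =>
    refine ⟨fun a b hab => ?_, fun a => ?_⟩
    · rw [pow_zero, Matrix.one_apply_ne hab.ne, map_zero, LinearMap.zero_apply]
    · rw [pow_zero, Matrix.one_apply_eq, map_one, Module.End.one_apply, ppVec_zero, one_smul]
  | succ p ih =>
    obtain ⟨ihU, ihD⟩ := ih
    -- the generator `E_{am}` on `(𝔼^p)_{mb} · v`, after commuting it through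
    have hstep : ∀ a m b : Fin n, a < m →
        ρ (stdB T n (τ, a, m)) (lift ℂ ρ ((genMatU n τ ^ p) m b) v) =
          lift ℂ ρ ((genMatU n τ ^ p) a b) v -
            (if a = b then lift ℂ ρ ((genMatU n τ ^ p) m m) v else 0) := by
      intro a m b ham
      rw [rho_stdB_lift_apply, hw_apply_stdB_upper hv (show IsUpper ((τ, a, m) : Idx T n) from ham),
        map_zero, add_zero, adU_genMatU_pow_apply, if_pos rfl, map_sub, LinearMap.sub_apply]
      congr 1
      split_ifs <;> simp
    -- expansion of the `(p+1)`-st power along the first factor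
    have hexp : ∀ a b : Fin n, lift ℂ ρ ((genMatU n τ ^ (p + 1)) a b) v =
        ∑ m, ρ (stdB T n (τ, a, m)) (lift ℂ ρ ((genMatU n τ ^ p) m b) v) := by
      intro a b
      rw [pow_succ', Matrix.mul_apply, map_sum, LinearMap.sum_apply]
      refine Finset.sum_congr rfl fun m _ => ?_
      rw [map_mul, genMatU_apply, lift_ι_apply, Module.End.mul_apply]
    refine ⟨fun a b hab => ?_, fun a => ?_⟩
    · -- raising entries: every term vanishes
      rw [hexp]
      refine Finset.sum_eq_zero fun m _ => ?_
      rcases lt_trichotomy m b with hmb | hmb | hbm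
      · rw [ihU m b hmb, map_zero]
      · rw [hmb, ihD b, map_smul, hw_apply_stdB_upper hv (show IsUpper ((τ, a, b) : Idx T n) from hab),
          smul_zero]
      · rw [hstep a m b (hab.trans hbm), ihU a b hab, if_neg hab.ne, sub_zero]
    · -- diagonal entries: `λ_a s_a + Σ_{m>a} (s_a − s_m)`
      rw [hexp]
      have hterm : ∀ m : Fin n, ρ (stdB T n (τ, a, m)) (lift ℂ ρ ((genMatU n τ ^ p) m a) v) =
          (if m = a then (l τ a * ppVec (l τ) p a) • v else 0) +
            (if a < m then (ppVec (l τ) p a - ppVec (l τ) p m) • v else 0) := by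
        intro m
        rcases lt_trichotomy m a with hma | hma | ham
        · rw [ihU m a hma, map_zero, if_neg hma.ne, if_neg (lt_asymm hma), add_zero]
        · rw [hma, ihD a, map_smul, hw_apply_stdB_diag hv τ a, smul_smul, if_pos rfl, if_neg (lt_irrefl _),
            add_zero, mul_comm]
        · rw [hstep a m a ham, if_pos rfl, ihD a, ihD m, if_neg ham.ne', if_pos ham, zero_add, sub_smul]
      rw [Finset.sum_congr rfl fun m _ => hterm m, Finset.sum_add_distrib, Finset.sum_ite_eq' Finset.univ a,
        if_pos (Finset.mem_univ a), ← Finset.sum_filter, ← Finset.sum_smul, ← add_smul, ppVec_succ]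

/-- **[BDGIL24, (9)–(10)] (Perelomov–Popov): `C_p · v = Tr(A_λ^p E) · v`** for every highest weight
vector `v` of weight `λ` of a representation of `gl_n` (block `τ` of `gl_n^T`; `C_p = tr(𝔼_τ^p)` the
Casimir element (8), `HCCore.casimir`; `A_λ = ppMatrix (λ τ)` the matrix (10), `E` the all-ones
matrix) — hence the central character of the irreducible representation `V_λ` takes the value
`χ_λ(C_p) = Tr(A_λ^p E)` ("The eigenvalues of these Casimir elements on irreducible representations
of `gl_k` are computed by Perelomov and Popov [PP68]").
[cite: BergEtAl2024, eq. (9)–(10), p.21 (PDF p.22)] locator: paper:arxiv-2411.03444 p0022.txt:L32–L45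
[cite: PerelomovPopov1968] ([PP68] of [BDGIL24, (9)]; attribution, source not held) -/
theorem eq_9_perelomovPopov (hv : IsHighestWeightVectorC ρ l v) (τ : T) (p : ℕ) :
    lift ℂ ρ (casimir n τ p) v =
      Matrix.trace (ppMatrix (l τ) ^ p * Matrix.of fun _ _ : Fin n => (1 : ℂ)) • v := by
  rw [trace_ppMatrix_pow_mul_allOnes, Finset.sum_smul, casimir, Matrix.trace, map_sum, LinearMap.sum_apply]
  exact Finset.sum_congr rfl fun a _ => by
    rw [Matrix.diag_apply, (lift_genMatU_pow_apply_hw hv τ p).2 a]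

/-- In particular **`C_1 · v = |λ| · v`**, `|λ| = Σ_a λ_a` (`trace_ppMatrix_mul_allOnes`).
[cite: BergEtAl2024, Example 4.14, p.21 (PDF p.22)] locator: paper:arxiv-2411.03444 p0022.txt:L20–L21 -/
theorem lift_casimir_one_apply_hw (hv : IsHighestWeightVectorC ρ l v) (τ : T) :
    lift ℂ ρ (casimir n τ 1) v = (∑ a, l τ a) • v := by
  rw [eq_9_perelomovPopov hv τ 1, pow_one, trace_ppMatrix_mul_allOnes]

/-- The central character in Harish-Chandra-projection form takes the Perelomov–Popov value:
`(hcProj C_p)(λ) = Tr(A_λ^p E)` whenever `λ` is the weight of some highest weight vector.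
[cite: BergEtAl2024, eq. (9), p.21 (PDF p.22)] -/
theorem eval_hcProj_casimir_eq_trace (hv : IsHighestWeightVectorC ρ l v) (τ : T) (p : ℕ) :
    MvPolynomial.eval (fun q : T × Fin n => l q.1 q.2) (hcProj T n (casimir n τ p)) =
      Matrix.trace (ppMatrix (l τ) ^ p * Matrix.of fun _ _ : Fin n => (1 : ℂ)) := by
  have h1 := lift_center_hw hv (casimir_mem_center (n := n) τ p)
  rw [eq_9_perelomovPopov hv τ p] at h1
  exact (smul_left_injective ℂ hv.1 h1).symm

end HW

/-! ### On the isotypic components of the metapolynomials `ℂ[ℂ[x₁,…,x_k]_d]_δ` -/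

section Meta

open Literature.Computability.AlgebraicComplexity Literature.NumberTheory.DiophantineGeometry

variable {k d : ℕ} {T : Type*} [Fintype T] [DecidableEq T] (τ₀ : T)

omit [Fintype T] in
/-- The weight `blockWt τ₀ χ` restricted to its block is `χ`. [cite: BergEtAl2024, §4.2, p.17 (PDF p.18)] -/
theorem blockWt_self_fun (χ : Weight (Fin k)) :
    blockWt τ₀ χ τ₀ = fun i : Fin k => ((χ i : ℤ) : ℂ) :=
  funext fun i => blockWt_self τ₀ χ i

/-- **The Casimir element `C_p` acts on the `λ`-isotypic component of `ℂ[ℂ[x₁,…,x_k]_d]_δ` by the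
Perelomov–Popov scalar `Tr(A_λ^p E)`** ([BDGIL24, Remark 5.3]: "these values … can be computed
using eq. (9)"; Example 5.4: `C_2` scales the `(6,0,0)`, `(4,2,0)`, `(2,2,2)`-isotypic components of
format `(3,2,3)` by `48`, `28`, `12`): for `Δ` homogeneous of degree `δ` in `hwSubrep (coordRep) λ`,
`C_p · Δ = Tr(A_λ^p E) Δ` (`envActGL_casimir_apply_of_mem_hwSubrep` + `eq_9_perelomovPopov` on a
highest weight vector of weight `λ`, which exists when the component is nonzero,
`highestWeightSpace_ne_bot_of_mem_hwSubrep`).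
[cite: BergEtAl2024, eq. (9)–(10) p.21 (PDF p.22); Remark 5.3 and Example 5.4, p.26 (PDF p.27)] locator: paper:arxiv-2411.03444 p0022.txt:L32–L45, p0027.txt:L11–L21 -/
theorem envActGL_casimir_apply_eq_trace {δ : ℕ} {χ : Weight (Fin k)}
    {Δ : MvPolynomial (DegIdx (Fin k) d) ℂ} (hΔ : Δ.IsHomogeneous δ)
    (hΔχ : Δ ∈ hwSubrep (coordRep (Fin k) ℂ d) χ) (p : ℕ) :
    envActGL k d τ₀ (casimir k τ₀ p) Δ =
      Matrix.trace (ppMatrix (fun i : Fin k => ((χ i : ℤ) : ℂ)) ^ p *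
        Matrix.of fun _ _ : Fin k => (1 : ℂ)) • Δ := by
  classical
  by_cases hΔ0 : Δ = 0
  · rw [hΔ0, map_zero, smul_zero]
  -- a nonzero highest weight vector of weight `χ` exists
  obtain ⟨v, hv, hv0⟩ := (Submodule.ne_bot_iff _).1 (highestWeightSpace_ne_bot_of_mem_hwSubrep hΔχ hΔ0)
  have hvC := isHighestWeightVectorC_of_mem_highestWeightSpace τ₀ hv hv0
  rw [envActGL_casimir_apply_of_mem_hwSubrep τ₀ hΔ hΔχ p, eval_hcProj_casimir_eq_trace hvC τ₀ p,
    blockWt_self_fun]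

end Meta

end BergEtAl2024

end Literature.Barriers.ValiantsHypothesis
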